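import Summits.AnomalousDissipation.AnomalousDissipation.Theorems.SolenoidalFractalHomogenisationLagrangianStepFrameFromEulerian
import Summits.AnomalousDissipation.AnomalousDissipation.Theorems.SolenoidalFractalHomogenisationLagrangianStepFrameToEulerianMembers
import Summits.AnomalousDissipation.AnomalousDissipation.Theorems.SolenoidalFractalHomogenisationLagrangianRenormalisationStepExistsL
import Literature.Analysis.FluidPDE.PassiveVectorTensorLionsExistence
import Literature.Analysis.FluidPDE.PassiveVectorTensorTimeDilation
import HarnessLib

/-!
# K1L_D (stmt-AnomalousDissipation-27980), v2 road (memo L22 §4) step (5a): EXISTENCE of distorted weak solutions along the clamped frame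
# curve — the `exists_sol` input for the two conjugate members (helper, `--supports 27980 --as helper`; prover lead-k1l-onelevel-p1 g7)

For a closed piece `[jR, t]` of a refresh window, a cell tensor `𝔸c` with `a • 𝔸c = 𝔸E`, `𝔸E` uniformly elliptic (`NearIso 𝔸E lo hi`,
`lo > 0`), a continuous weakly solenoidal Eulerian carrier `B` and a continuous weakly solenoidal frame carrier `bc` tied by the relation
`∇X · bc(σ₁+τ) = (1/a)(B − b_{≤m})(t′) ∘ X` of (C6), EVERY `L²` datum `φ` with `∇·(G(σ₁) φ) = 0` weakly has a distorted weak solution on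
`(0, a(t−jR) − σ₁)` along `τ ↦ bc (σ₁+τ)` and the clamped frame curve (`exists_isWeakTensorPassiveVectorDistortedOn_phys`): Lions' Eulerian
existence (`Torus.exists_isWeakTensorPassiveVectorOn`, physical time, datum `φ ∘ X m jR (jR+σ₁/a)`), time dilation to cell time
(`IsWeakTensorPassiveVectorOn.comp_mul_time` by `1/a`), and the converse reading `isWeakTensorPassiveVectorDistortedOn_of_eulerian` (step (4)).
§2 specialises to the TRUE member (`bc = cellField`, `B = b_{≤m+1}`, `𝔸E = kbar(m+1) • S`) and the COARSE member (`bc = 0`, `B = b_{≤m}`,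
`𝔸E = kbar m • renormStep …`), literally in the shape of the future field `exists_sol` of the v2 propagator spec for
`isDistortedPropagator_conjProp_clamped`'s member (tenure RULING D28-10 (c)).
No sorry, no definition, no named fact.  NOT the spec amendment, NOT a proof of `stub_Vmod_EHTthg`, of K1L_D or AD; rung F-D1.A0.
-/

set_option linter.dupNamespace false

noncomputable section

namespace Summit.AnomalousDissipation.AnomalousDissipation.Theorems.SolenoidalFractalHomogenisation.LagrangianStep.FrameConj

open Set Function Filter MeasureTheory Topology
open scoped NNReal ENNReal InnerProductSpace
open Literature.Analysis Literature.Analysis.FunctionSpaces Literature.Analysis.FunctionSpaces.Torus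
open Literature.Analysis.FluidPDE Literature.Analysis.FluidPDE.LatticeShear
open Literature.Analysis.FluidPDE.LatticeShear (LagrangianLatticeCarrier LatticeWord)
open Summit.AnomalousDissipation.AnomalousDissipation.Theorems.SolenoidalFractalHomogenisation.LagrangianRenormalisationStep
  (memLp_top_stLift_of_continuous cellVisc_pos')
open Summit.AnomalousDissipation.AnomalousDissipation.Theorems.SolenoidalFractalHomogenisation.RealisedQuasiStaticCellLaw
  (continuous_uncurry_cell isDivFree_cell isSmooth_cell)

variable {k : ℕ}

/-! ## §1 Existence along the clamped frame curve, general member, modulo the carrier relation -/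

/-- **Distorted weak solutions EXIST along the clamped frame curve** (Lions ∘ time dilation ∘ the converse reading).  See the module docstring. -/
theorem exists_isWeakTensorPassiveVectorDistortedOn_phys (E : LagrangianLatticeCarrier k) (hR : E.LevelRegular) {m : ℕ} (hF : E.IsFlow m)
    (j : ℤ) {t : ℝ} (hjt : (j : ℝ) * E.refresh (m + 1) ≤ t) (htR : t ≤ (j : ℝ) * E.refresh (m + 1) + E.refresh (m + 1))
    {𝔸c 𝔸E : FluidPDE.Torus.Visc4 (Fin 3)} (h𝔸 : E.a (m + 1) • 𝔸c = 𝔸E) {lo hi : ℝ} (hiso : FluidPDE.Torus.NearIso 𝔸E lo hi)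
    (hlo : 0 < lo) {bc B : ℝ → UnitAddTorus (Fin 3) → EuclideanSpace ℝ (Fin 3)}
    (hB : Continuous (uncurry B)) (hBdiv : ∀ t', Torus.IsWeaklyDivFree (B t'))
    (hbc : Continuous (uncurry bc)) (hbcdiv : ∀ σ, Torus.IsWeaklyDivFree (bc σ))
    (hRB : ∀ σ₁ : ℝ, 0 ≤ σ₁ → ∀ τ ∈ Ioo 0 (E.a (m + 1) * (t - (j : ℝ) * E.refresh (m + 1)) - σ₁), ∀ y,
      E.flowDeriv m ((j : ℝ) * E.refresh (m + 1) + (σ₁ + τ) / E.a (m + 1)) ((j : ℝ) * E.refresh (m + 1)) y (bc (σ₁ + τ) y)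
        = (1 / E.a (m + 1)) • B ((j : ℝ) * E.refresh (m + 1) + (σ₁ + τ) / E.a (m + 1))
            (E.X m ((j : ℝ) * E.refresh (m + 1) + (σ₁ + τ) / E.a (m + 1)) ((j : ℝ) * E.refresh (m + 1)) y)
          - (1 / E.a (m + 1)) • E.partialSum m ((j : ℝ) * E.refresh (m + 1) + (σ₁ + τ) / E.a (m + 1))
              (E.X m ((j : ℝ) * E.refresh (m + 1) + (σ₁ + τ) / E.a (m + 1)) ((j : ℝ) * E.refresh (m + 1)) y)) :
    ∀ σ₁ : ℝ, 0 ≤ σ₁ → σ₁ < E.a (m + 1) * (t - (j : ℝ) * E.refresh (m + 1)) →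
      ∀ (φ : UnitAddTorus (Fin 3) → EuclideanSpace ℝ (Fin 3)), MemLp φ 2 volume →
      Torus.IsWeaklyDivFree (FluidPDE.Torus.distort
        (frameG E m ((j : ℝ) * E.refresh (m + 1) + σ₁ / E.a (m + 1)) ((j : ℝ) * E.refresh (m + 1))) φ) →
      ∃ w : ℝ → UnitAddTorus (Fin 3) → EuclideanSpace ℝ (Fin 3),
      FluidPDE.Torus.IsWeakTensorPassiveVectorDistortedOn 0 (E.a (m + 1) * (t - (j : ℝ) * E.refresh (m + 1)) - σ₁) 𝔸c
        (fun τ => bc (σ₁ + τ))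
        (fun τ y => frameG E m ((j : ℝ) * E.refresh (m + 1) +
          max 0 (min (σ₁ + τ) (E.a (m + 1) * (t - (j : ℝ) * E.refresh (m + 1)))) / E.a (m + 1)) ((j : ℝ) * E.refresh (m + 1)) y)
        φ w := by
  intro σ₁ hσ₁ hσ₁T φ hφ hdiv
  set w : ℝ := (j : ℝ) * E.refresh (m + 1) with hw
  have ha : 0 < E.a (m + 1) := E.a_pos (m + 1)
  have ha' : E.a (m + 1) ≠ 0 := ha.ne'
  set t₁ : ℝ := w + σ₁ / E.a (m + 1) with ht₁
  -- the physical horizon is positive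
  have hTph : 0 < t - t₁ := by
    have h1 : σ₁ / E.a (m + 1) < t - w := by rw [div_lt_iff₀ ha]; linarith [mul_comm (E.a (m + 1)) (t - w)]
    rw [ht₁]; linarith
  -- inverse pairs of flow maps
  have hXX : ∀ (t'' : ℝ) (y : UnitAddTorus (Fin 3)), E.X m w t'' (E.X m t'' w y) = y := fun t'' y => by
    have h := congrFun (hR.X_comp_X m w t'' w) y
    rw [Function.comp_apply, hR.X_self m w] at h
    exact h
  -- the Eulerian datum `φE := φ ∘ X m jR t₁` (backward reading): `L²`, weakly divergence free
  set φE : UnitAddTorus (Fin 3) → EuclideanSpace ℝ (Fin 3) := fun x => φ (E.X m w t₁ x) with hφEdef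
  have hφE : MemLp φE 2 volume := hφ.comp_measurePreserving (hR.measurePreserving_X m w t₁)
  have hread : (fun y => φE (E.X m t₁ w y)) = φ := by
    funext y
    simp only [hφEdef, hXX]
  have hφEdiv : Torus.IsWeaklyDivFree φE := by
    set U : V2 := hφE.toLp φE with hU
    have hUφ : (⇑U : VF) =ᵐ[volume] φE := hφE.coeFn_toLp
    have h1 : (⇑(frameRead E hR m w σ₁ U) : VF) =ᵐ[volume] fun y => φE (E.X m t₁ w y) :=
      (frameRead_coeFn E hR m w σ₁ U).trans ((hR.measurePreserving_X m t₁ w).quasiMeasurePreserving.ae_eq_comp hUφ)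
    rw [hread] at h1
    have h2 : Torus.IsWeaklyDivFree (FluidPDE.Torus.distort (frameG E m t₁ w) (⇑(frameRead E hR m w σ₁ U) : VF)) := by
      refine hdiv.congr_ae ?_
      filter_upwards [h1] with y hy
      simp only [FluidPDE.Torus.distort, hy]
    exact ((isWeaklyDivFree_distort_frameRead_iff' E hR m w σ₁ U).1 h2).congr_ae hUφ
  -- Lions: an Eulerian weak solution from `φE` along `τ' ↦ B (t₁ + τ')`, physical time, tensor `𝔸E`
  have hBph : Continuous (uncurry fun (τ' : ℝ) (x : UnitAddTorus (Fin 3)) => B (t₁ + τ') x) :=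
    hB.comp (((continuous_const.add continuous_fst)).prodMk continuous_snd)
  obtain ⟨uE, huE⟩ := FluidPDE.Torus.exists_isWeakTensorPassiveVectorOn hTph hiso hlo
    (memLp_top_stLift_of_continuous hBph (t - t₁)) (ae_of_all _ fun τ' => hBdiv (t₁ + τ')) hφE hφEdiv
  -- time dilation to cell time `τ = a τ'`
  have hdil := huE.comp_mul_time (a := 1 / E.a (m + 1)) (by positivity)
  have eT : (t - t₁) / (1 / E.a (m + 1)) = E.a (m + 1) * (t - w) - σ₁ := by
    rw [ht₁]; field_simp; ring
  have e𝔸 : (1 / E.a (m + 1)) • 𝔸E = 𝔸c := by rw [← h𝔸, inv_smul_smul_visc ha]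
  have eclock : ∀ s : ℝ, t₁ + 1 / E.a (m + 1) * s = w + (σ₁ + s) / E.a (m + 1) := fun s => by
    rw [ht₁]; field_simp; ring
  have eb : (fun (s : ℝ) (x : UnitAddTorus (Fin 3)) => (1 / E.a (m + 1)) •
        (fun (τ' : ℝ) (x : UnitAddTorus (Fin 3)) => B (t₁ + τ') x) (1 / E.a (m + 1) * s) x)
      = fun τ x => (1 / E.a (m + 1)) • B (w + (σ₁ + τ) / E.a (m + 1)) x := by
    funext s x
    simp only [eclock]
  rw [eT, e𝔸, eb] at hdil
  -- the cell-time Eulerian carrier is continuous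
  have hθ : Continuous fun τ : ℝ => w + (σ₁ + τ) / E.a (m + 1) := by fun_prop
  have hBt : Continuous (uncurry fun (τ : ℝ) (x : UnitAddTorus (Fin 3)) => (1 / E.a (m + 1)) • B (w + (σ₁ + τ) / E.a (m + 1)) x) :=
    (hB.comp ((hθ.comp continuous_fst).prodMk continuous_snd)).const_smul (1 / E.a (m + 1))
  -- the converse reading
  have hsol := isWeakTensorPassiveVectorDistortedOn_of_eulerian E hR hF j hjt htR hσ₁ hσ₁T.le rfl
    (𝔸c := 𝔸c) (bc := bc) (Bt := fun τ x => (1 / E.a (m + 1)) • B (w + (σ₁ + τ) / E.a (m + 1)) x)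
    hBt hbc hbcdiv (hRB σ₁ hσ₁) hφE hdil
  rw [hread] at hsol
  exact ⟨_, hsol⟩

/-! ## §2 The two members -/

/-- **`exists_sol` for the TRUE member** (`bc = cellField …`, `𝔸c = (1/N²)•(ν_c•S)`, `B = partialSum (m+1)`, `𝔸E = kbar (m+1) • S`
uniformly elliptic) — the shape of the v2 field for `isDistortedPropagator_conjProp_clamped`'s true member at `s = jR`. -/
theorem exists_sol_true (E : LagrangianLatticeCarrier k) (hL : E.LPermissible) (hR : E.LevelRegular) {W : LatticeWord k} {M : ℝ}
    {hM : 0 < M} (hdes : E.design = W.stretch M hM) (m j : ℕ) {t : ℝ} (hjt : (j : ℝ) * E.refresh (m + 1) ≤ t)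
    (htR : t ≤ (j : ℝ) * E.refresh (m + 1) + E.refresh (m + 1)) (S : FluidPDE.Torus.Visc4 (Fin 3)) (hν : 0 < E.cellVisc (m + 1))
    {lo₁ hi₁ : ℝ} (h𝔸1 : FluidPDE.Torus.NearIso (E.kbar (m + 1) • S) lo₁ hi₁) (hlo₁ : 0 < lo₁) :
    ∀ σ₁ : ℝ, 0 ≤ σ₁ → σ₁ < E.a (m + 1) * (t - (j : ℝ) * E.refresh (m + 1)) →
      ∀ (φ : UnitAddTorus (Fin 3) → EuclideanSpace ℝ (Fin 3)), MemLp φ 2 volume →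
      Torus.IsWeaklyDivFree (FluidPDE.Torus.distort
        (frameG E m ((j : ℝ) * E.refresh (m + 1) + σ₁ / E.a (m + 1)) ((j : ℝ) * E.refresh (m + 1))) φ) →
      ∃ w : ℝ → UnitAddTorus (Fin 3) → EuclideanSpace ℝ (Fin 3),
      FluidPDE.Torus.IsWeakTensorPassiveVectorDistortedOn 0 (E.a (m + 1) * (t - (j : ℝ) * E.refresh (m + 1)) - σ₁)
        ((1 / (E.N (m + 1) : ℝ) ^ 2) • (E.cellVisc (m + 1) • S))
        (fun τ => cellField W M hM (E.cellVisc (m + 1)) hν (E.N (m + 1)) (σ₁ + τ))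
        (fun τ y => frameG E m ((j : ℝ) * E.refresh (m + 1) +
          max 0 (min (σ₁ + τ) (E.a (m + 1) * (t - (j : ℝ) * E.refresh (m + 1)))) / E.a (m + 1)) ((j : ℝ) * E.refresh (m + 1)) y)
        φ w := by
  have hF : E.IsFlow m := (hL.isLagrangian m).1
  have hbc : Continuous (uncurry (cellField W M hM (E.cellVisc (m + 1)) hν (E.N (m + 1)))) := continuous_uncurry_cell _ (E.N (m + 1))
  have hbcdiv : ∀ σ, Torus.IsWeaklyDivFree (cellField W M hM (E.cellVisc (m + 1)) hν (E.N (m + 1)) σ) :=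
    fun σ => (isDivFree_cell _ (E.N (m + 1)) σ).isWeaklyDivFree_holds (isSmooth_cell _ (E.N (m + 1)) σ)
  have h := exists_isWeakTensorPassiveVectorDistortedOn_phys E hR hF (j : ℤ) (t := t) (by push_cast; exact hjt)
    (by push_cast; exact htR) (𝔸c := (1 / (E.N (m + 1) : ℝ) ^ 2) • (E.cellVisc (m + 1) • S)) (𝔸E := E.kbar (m + 1) • S)
    (smul_cellTensor_eq E m S) h𝔸1 hlo₁ (bc := cellField W M hM (E.cellVisc (m + 1)) hν (E.N (m + 1))) (B := E.partialSum (m + 1))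
    (hR.continuous_uncurry_partialSum (m + 1)) (fun t' => isWeaklyDivFree_partialSum E hR (m + 1) t') hbc hbcdiv
    (by push_cast; exact fun σ₁ hσ₁ τ hτ y => flowDeriv_cellField_eq E hL hdes m j htR hσ₁ hν hτ y)
  push_cast at h
  exact h

/-- **`exists_sol` for the COARSE member** (`bc = 0`, `𝔸c = (1/N²)•(ν_c•S + (c/ν_c)•Φ_ν((1/ν_c)•(ν_c•S)))`, `B = partialSum m`,
`𝔸E = kbar m • renormStep (Φ ν_c) (c/ν_c²) S` uniformly elliptic, `c = E.gain`). -/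
theorem exists_sol_coarse (E : LagrangianLatticeCarrier k) (hL : E.LPermissible) (hR : E.LevelRegular) (m j : ℕ) {t : ℝ}
    (hjt : (j : ℝ) * E.refresh (m + 1) ≤ t) (htR : t ≤ (j : ℝ) * E.refresh (m + 1) + E.refresh (m + 1))
    (Φ : ℝ → FluidPDE.Torus.Visc4 (Fin 3) → FluidPDE.Torus.Visc4 (Fin 3)) (S : FluidPDE.Torus.Visc4 (Fin 3))
    {lo₀ hi₀ : ℝ} (h𝔸0 : FluidPDE.Torus.NearIso (E.kbar m • renormStep (Φ (E.cellVisc (m + 1))) (E.gain / E.cellVisc (m + 1) ^ 2) S) lo₀ hi₀)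
    (hlo₀ : 0 < lo₀) :
    ∀ σ₁ : ℝ, 0 ≤ σ₁ → σ₁ < E.a (m + 1) * (t - (j : ℝ) * E.refresh (m + 1)) →
      ∀ (φ : UnitAddTorus (Fin 3) → EuclideanSpace ℝ (Fin 3)), MemLp φ 2 volume →
      Torus.IsWeaklyDivFree (FluidPDE.Torus.distort
        (frameG E m ((j : ℝ) * E.refresh (m + 1) + σ₁ / E.a (m + 1)) ((j : ℝ) * E.refresh (m + 1))) φ) →
      ∃ w : ℝ → UnitAddTorus (Fin 3) → EuclideanSpace ℝ (Fin 3),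
      FluidPDE.Torus.IsWeakTensorPassiveVectorDistortedOn 0 (E.a (m + 1) * (t - (j : ℝ) * E.refresh (m + 1)) - σ₁)
        ((1 / (E.N (m + 1) : ℝ) ^ 2) • (E.cellVisc (m + 1) • S +
          (E.gain / E.cellVisc (m + 1)) • Φ (E.cellVisc (m + 1)) ((1 / E.cellVisc (m + 1)) • (E.cellVisc (m + 1) • S))))
        (fun τ => (fun (_ : ℝ) (_ : UnitAddTorus (Fin 3)) => (0 : EuclideanSpace ℝ (Fin 3))) (σ₁ + τ))
        (fun τ y => frameG E m ((j : ℝ) * E.refresh (m + 1) +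
          max 0 (min (σ₁ + τ) (E.a (m + 1) * (t - (j : ℝ) * E.refresh (m + 1)))) / E.a (m + 1)) ((j : ℝ) * E.refresh (m + 1)) y)
        φ w := by
  have hF : E.IsFlow m := (hL.isLagrangian m).1
  have hνpos : 0 < E.cellVisc (m + 1) := cellVisc_pos' E.toFractalCarrierData (m + 1)
  have h𝔸 : E.a (m + 1) • ((1 / (E.N (m + 1) : ℝ) ^ 2) • (E.cellVisc (m + 1) • S +
      (E.gain / E.cellVisc (m + 1)) • Φ (E.cellVisc (m + 1)) ((1 / E.cellVisc (m + 1)) • (E.cellVisc (m + 1) • S))))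
      = E.kbar m • renormStep (Φ (E.cellVisc (m + 1))) (E.gain / E.cellVisc (m + 1) ^ 2) S := by
    rw [inv_smul_smul_visc hνpos, smul_coarseTensor_eq E hL m (Φ (E.cellVisc (m + 1))) S]
  have hbc : Continuous (uncurry fun (_ : ℝ) (_ : UnitAddTorus (Fin 3)) => (0 : EuclideanSpace ℝ (Fin 3))) := continuous_const
  have hbcdiv : ∀ σ : ℝ, Torus.IsWeaklyDivFree ((fun (_ : ℝ) (_ : UnitAddTorus (Fin 3)) => (0 : EuclideanSpace ℝ (Fin 3))) σ) :=
    fun σ θ hθ => by simp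
  have hrel : ∀ σ₁ : ℝ, 0 ≤ σ₁ → ∀ τ ∈ Ioo 0 (E.a (m + 1) * (t - ((j : ℤ) : ℝ) * E.refresh (m + 1)) - σ₁), ∀ y,
      E.flowDeriv m (((j : ℤ) : ℝ) * E.refresh (m + 1) + (σ₁ + τ) / E.a (m + 1)) (((j : ℤ) : ℝ) * E.refresh (m + 1)) y
        ((fun (_ : ℝ) (_ : UnitAddTorus (Fin 3)) => (0 : EuclideanSpace ℝ (Fin 3))) (σ₁ + τ) y)
      = (1 / E.a (m + 1)) • E.partialSum m (((j : ℤ) : ℝ) * E.refresh (m + 1) + (σ₁ + τ) / E.a (m + 1))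
          (E.X m (((j : ℤ) : ℝ) * E.refresh (m + 1) + (σ₁ + τ) / E.a (m + 1)) (((j : ℤ) : ℝ) * E.refresh (m + 1)) y)
        - (1 / E.a (m + 1)) • E.partialSum m (((j : ℤ) : ℝ) * E.refresh (m + 1) + (σ₁ + τ) / E.a (m + 1))
          (E.X m (((j : ℤ) : ℝ) * E.refresh (m + 1) + (σ₁ + τ) / E.a (m + 1)) (((j : ℤ) : ℝ) * E.refresh (m + 1)) y) :=
    fun σ₁ _ τ _ y => by rw [map_zero, sub_self]
  have h := exists_isWeakTensorPassiveVectorDistortedOn_phys E hR hF (j : ℤ) (t := t) (by push_cast; exact hjt)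
    (by push_cast; exact htR)
    (𝔸c := (1 / (E.N (m + 1) : ℝ) ^ 2) • (E.cellVisc (m + 1) • S +
      (E.gain / E.cellVisc (m + 1)) • Φ (E.cellVisc (m + 1)) ((1 / E.cellVisc (m + 1)) • (E.cellVisc (m + 1) • S))))
    (𝔸E := E.kbar m • renormStep (Φ (E.cellVisc (m + 1))) (E.gain / E.cellVisc (m + 1) ^ 2) S) h𝔸 h𝔸0 hlo₀
    (bc := fun (_ : ℝ) (_ : UnitAddTorus (Fin 3)) => (0 : EuclideanSpace ℝ (Fin 3))) (B := E.partialSum m)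
    (hR.continuous_uncurry_partialSum m) (fun t' => isWeaklyDivFree_partialSum E hR m t') hbc hbcdiv hrel
  push_cast at h
  exact h

end Summit.AnomalousDissipation.AnomalousDissipation.Theorems.SolenoidalFractalHomogenisation.LagrangianStep.FrameConj

end
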